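import Mathlib
import Summits.NavierStokesRegularity.NavierStokesRegularity.Theorems.FilamentSkeletonRssDefectColumnGateAzimuthalBlockCoreDissip
import Summits.NavierStokesRegularity.NavierStokesRegularity.Theorems.FilamentSkeletonRssDefectColumnGateAzimuthalBlockCoreGaussPrelim

/-!
# Route `FilamentSkeletonRss` · crux `TransverseReduction1AG` (stmt-NavierStokesRegularity-27853; A1L twin stmt-23297) · line
# `defect_column_gate_1AG/1AL` — the TRUNCATED-CORE sup bound for the Biot–Savart-coupled azimuthal blocks `m ≥ 2` of S2a-loc
# `WaistColumnGateLoc1A`: the fast-rotation bound on a core `[0, u₁]` with the boundary fluxes at `u₁` and the exterior Biot–Savart remainder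
# as explicit additive terms — stage 1 of the two-zone assembly

Helper file (`--supports stmt-NavierStokesRegularity-27853 --as helper`; seat ns-filament-s2aloc-p1 g2; note ARCHITECTURE-B2B3-s2aloc-g2.md v3 §7).
This is `coreGauss_sup_sq_le` (`…CoreGauss.lean`, p675134) with the support radius `U` replaced by an arbitrary truncation radius `u₁ ≤ U`: the
identities are `core_rotation_coercivity_trunc` / `core_dissipation_trunc`, so three extra terms appear and are carried to the conclusion —
`B₁ = E(u₁)(aΦ_b − bΦ_a)(u₁)` (rotation boundary flux), `B₂ = E(u₁)(aΦ_a + bΦ_b − γu₁(a²+b²))(u₁)` (modulus boundary flux),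
`X = ∫_{u₁}^U u(a²+b²)` (exterior Biot–Savart remainder):
`coreTrunc_sup_sq_le`:  for `u ∈ [0, u₁]`,
`a² + b² ≤ (M²u₁E(u₁)/Rc)(4K((γ+1)K+4)/c₁² + 1/2) + (4((γ+1)K+4)/c₁)·B₁ + B₂ + (γ²Rc/16πm)(1 + 4((γ+1)K+4)/c₁)·X`,
`K = 2π(u₁ + 4/γ)`, `c₁ = (1 − 16/(5m²))m`, whenever `Rc ≥ 1`, `40π|ρ|(u₁ + 4/γ) ≤ Rc`.  In the two-zone scheme `u₁ ≍ (4A/γ)log Rc` so `E(u₁) = Rc^{O(1)}`,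
`B₁, B₂` are made small by the layer choice (`exists_mul_le_integral`, `layer_dissipation_le`) and `X ≤ Q/(2u₁²)` by the exterior lemma
(`exterior_feed_le`); that final assembly is not done here.
HONEST FRAMING: an a-priori bound for ONE family of blocks of ONE linear MODEL operator of a hypothetical blow-up route (MODEL rung, negative side);
nothing here bears on NS regularity.
-/

set_option linter.dupNamespace false

noncomputable section

namespace Summit.NavierStokesRegularity.NavierStokesRegularity.Theorems.DefectColumnGate

open scoped Topology
open Set Filter MeasureTheory intervalIntegral

/-- (Im)-algebra with an additive remainder `Z`: `c₁Rc𝒞 + mρIE ≤ I_rot + Z`, `IE ≤ K𝒞`, `I_rot ≤ (η/2)IE + X/η` (`η = c₁Rc/K`),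
`m|ρ|K ≤ c₁Rc/4` ⇒ `𝒞 ≤ 4KX/(c₁²Rc²) + 4Z/(c₁Rc)`. -/
theorem gauss_currency_bound_rem {𝒞 IE Irot X Z K c₁ Rc m ρ : ℝ} (hK : 0 < K) (hc₁ : 0 < c₁) (hRc : 0 < Rc) (hm : 0 < m)
    (h𝒞 : 0 ≤ 𝒞) (hIE : 0 ≤ IE)
    (hP : IE ≤ K * 𝒞) (hIm : c₁ * Rc * 𝒞 + m * ρ * IE ≤ Irot + Z)
    (hrot : Irot ≤ (c₁ * Rc / K) / 2 * IE + X / (c₁ * Rc / K))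
    (hρ : m * |ρ| * K ≤ c₁ * Rc / 4) :
    𝒞 ≤ 4 * K * X / (c₁ ^ 2 * Rc ^ 2) + 4 * Z / (c₁ * Rc) := by
  have h1 : (c₁ * Rc / K) / 2 * IE ≤ c₁ * Rc / 2 * 𝒞 := by
    have := mul_le_mul_of_nonneg_left hP (show 0 ≤ (c₁ * Rc / K) / 2 by positivity)
    have e : (c₁ * Rc / K) / 2 * (K * 𝒞) = c₁ * Rc / 2 * 𝒞 := by field_simp
    linarith
  have h2 : X / (c₁ * Rc / K) = K * X / (c₁ * Rc) := by field_simp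
  have h3 : -(c₁ * Rc / 4 * 𝒞) ≤ m * ρ * IE := by
    have h4 : -(m * |ρ| * IE) ≤ m * ρ * IE := by
      have := neg_abs_le ρ
      have h5 : 0 ≤ m * IE := by positivity
      nlinarith
    have h6 : m * |ρ| * IE ≤ m * |ρ| * (K * 𝒞) := mul_le_mul_of_nonneg_left hP (by positivity)
    have h7 : m * |ρ| * (K * 𝒞) ≤ c₁ * Rc / 4 * 𝒞 := by
      have := mul_le_mul_of_nonneg_right hρ h𝒞
      linarith [mul_assoc (m * |ρ|) K 𝒞]
    linarith
  have h8 : c₁ * Rc / 4 * 𝒞 ≤ K * X / (c₁ * Rc) + Z := by linarith [hIm, hrot, h1, h2, h3]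
  have e : 4 * K * X / (c₁ ^ 2 * Rc ^ 2) + 4 * Z / (c₁ * Rc) = (K * X / (c₁ * Rc) + Z) * (4 / (c₁ * Rc)) := by
    field_simp
  rw [e, ← div_le_iff₀ (by positivity)]
  have e2 : 𝒞 / (4 / (c₁ * Rc)) = c₁ * Rc / 4 * 𝒞 := by field_simp
  rw [e2]; exact h8

/-- (Re)-algebra with remainders: `D + D₂ ≤ γIE + I_g + (16/(5m))Rc𝒞 + W`, `IE ≤ K𝒞`, `I_g ≤ Rc·IE + X/(2Rc)`,
`𝒞 ≤ 4KX/(c₁²Rc²) + 4Z/(c₁Rc)`, `Rc ≥ 1`, `m ≥ 2`, `0 ≤ KX/(c₁Rc) + Z` ⇒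
`D + D₂ ≤ (X/Rc)(4K((γ+1)K+4)/c₁² + 1/2) + 4((γ+1)K+4)Z/c₁ + W`. -/
theorem gauss_dissipation_bound_rem {DD 𝒞 IE Ig X Z W K c₁ Rc γ m : ℝ} (hK : 0 < K) (hc₁ : 0 < c₁) (hRc : 1 ≤ Rc) (hγ : 0 < γ)
    (hm : 2 ≤ m) (h𝒞0 : 0 ≤ 𝒞)
    (hRe : DD ≤ γ * IE + Ig + 16 / (5 * m) * Rc * 𝒞 + W) (hP : IE ≤ K * 𝒞)
    (hIg : Ig ≤ (2 * Rc) / 2 * IE + X / (2 * Rc)) (h𝒞 : 𝒞 ≤ 4 * K * X / (c₁ ^ 2 * Rc ^ 2) + 4 * Z / (c₁ * Rc)) :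
    DD ≤ X / Rc * (4 * K * ((γ + 1) * K + 4) / c₁ ^ 2 + 1 / 2) + 4 * ((γ + 1) * K + 4) * Z / c₁ + W := by
  have hRc0 : 0 < Rc := by linarith
  have hm0 : 0 < m := by linarith
  have h165 : 16 / (5 * m) * Rc * 𝒞 ≤ 4 * Rc * 𝒞 := by
    have : 16 / (5 * m) ≤ 4 := by rw [div_le_iff₀ (by positivity)]; nlinarith
    have := mul_le_mul_of_nonneg_right this (show 0 ≤ Rc * 𝒞 by positivity)
    linarith [mul_assoc (16 / (5 * m)) Rc 𝒞, mul_assoc (4:ℝ) Rc 𝒞]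
  have h1 : DD ≤ (γ + Rc) * K * 𝒞 + X / (2 * Rc) + 4 * Rc * 𝒞 + W := by
    have hγIE : γ * IE ≤ γ * (K * 𝒞) := mul_le_mul_of_nonneg_left hP hγ.le
    have hRcIE : (2 * Rc) / 2 * IE ≤ Rc * (K * 𝒞) := by
      have := mul_le_mul_of_nonneg_left hP hRc0.le; linarith
    linarith [hRe, hIg]
  have h2 : (γ + Rc) * K * 𝒞 + 4 * Rc * 𝒞 ≤ Rc * ((γ + 1) * K + 4) * 𝒞 := by
    have h21 : 0 ≤ γ * K * (Rc - 1) := mul_nonneg (mul_nonneg hγ.le hK.le) (by linarith)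
    have h22 : (γ + Rc) * K + 4 * Rc ≤ Rc * ((γ + 1) * K + 4) := by linarith
    have := mul_le_mul_of_nonneg_right h22 h𝒞0
    linarith
  have h3 : Rc * ((γ + 1) * K + 4) * 𝒞 ≤ Rc * ((γ + 1) * K + 4) * (4 * K * X / (c₁ ^ 2 * Rc ^ 2) + 4 * Z / (c₁ * Rc)) :=
    mul_le_mul_of_nonneg_left h𝒞 (by positivity)
  have e : Rc * ((γ + 1) * K + 4) * (4 * K * X / (c₁ ^ 2 * Rc ^ 2) + 4 * Z / (c₁ * Rc)) + X / (2 * Rc)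
      = X / Rc * (4 * K * ((γ + 1) * K + 4) / c₁ ^ 2 + 1 / 2) + 4 * ((γ + 1) * K + 4) * Z / c₁ := by
    field_simp
    ring
  linarith [h1, h2, h3, e]

set_option maxHeartbeats 1600000 in
/-- **Truncated-core sup bound with boundary fluxes and exterior remainder explicit (`m ≥ 2`).**  See the module docstring.
For all `u ∈ [0, u₁]` (`0 < u₁ ≤ U`, `Rc ≥ 1`, `40π|ρ|(u₁ + 4/γ) ≤ Rc`):
`a(u)² + b(u)² ≤ (M²u₁e^{γu₁/4}/Rc)(4K((γ+1)K+4)/c₁² + 1/2) + (4((γ+1)K+4)/c₁)·B₁ + B₂ + (γ²Rc/(16πm))(1 + 4((γ+1)K+4)/c₁)·X`. -/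
theorem coreTrunc_sup_sq_le {γ m ρ Rc u₁ U M : ℝ} {a a₁ b b₁ φa φa₁ φb φb₁ f₁ f₂ : ℝ → ℝ}
    (hγ : 0 < γ) (hm : 2 ≤ m) (hRc : 1 ≤ Rc) (hu₁ : 0 < u₁) (hu₁U : u₁ ≤ U) (hρ : 40 * Real.pi * |ρ| * (u₁ + 4 / γ) ≤ Rc)
    (ha : ContinuousOn a (Icc 0 U)) (hb : ContinuousOn b (Icc 0 U))
    (ha₁ : ContinuousOn a₁ (Ioc 0 U)) (hb₁ : ContinuousOn b₁ (Ioc 0 U))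
    (hφa : ContinuousOn φa (Icc 0 U)) (hφb : ContinuousOn φb (Icc 0 U))
    (hΦac : ContinuousOn (fun s => 4 * s * a₁ s + γ * s * a s) (Icc 0 U))
    (hΦbc : ContinuousOn (fun s => 4 * s * b₁ s + γ * s * b s) (Icc 0 U))
    (hPac : ContinuousOn (fun s => s * φa₁ s) (Icc 0 U)) (hPbc : ContinuousOn (fun s => s * φb₁ s) (Icc 0 U))
    (ha0 : a 0 = 0) (hb0 : b 0 = 0) (hφa0 : φa 0 = 0) (hφb0 : φb 0 = 0)
    (hdera : ∀ u ∈ Ioo 0 U, HasDerivAt a (a₁ u) u) (hderb : ∀ u ∈ Ioo 0 U, HasDerivAt b (b₁ u) u)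
    (hderφa : ∀ u ∈ Ioo 0 U, HasDerivAt φa (φa₁ u) u) (hderφb : ∀ u ∈ Ioo 0 U, HasDerivAt φb (φb₁ u) u)
    (hΦa : ∀ u ∈ Ioo 0 U, HasDerivAt (fun s => 4 * s * a₁ s + γ * s * a s)
      (m ^ 2 / u * a u - m * (ρ + Rc * ((1 - Real.exp (-(γ * u / 4))) / (2 * Real.pi * u))) * b u
        + γ * m * Rc / 2 * (γ / (4 * Real.pi) * Real.exp (-(γ * u / 4))) * φb u - f₁ u) u)
    (hΦb : ∀ u ∈ Ioo 0 U, HasDerivAt (fun s => 4 * s * b₁ s + γ * s * b s)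
      (m ^ 2 / u * b u + m * (ρ + Rc * ((1 - Real.exp (-(γ * u / 4))) / (2 * Real.pi * u))) * a u
        - γ * m * Rc / 2 * (γ / (4 * Real.pi) * Real.exp (-(γ * u / 4))) * φa u - f₂ u) u)
    (hPa : ∀ u ∈ Ioo 0 U, HasDerivAt (fun s => s * φa₁ s) ((m ^ 2 / u * φa u - a u) / 4) u)
    (hPb : ∀ u ∈ Ioo 0 U, HasDerivAt (fun s => s * φb₁ s) ((m ^ 2 / u * φb u - b u) / 4) u)
    (hφaU : φa U = 0) (hφbU : φb U = 0)
    (hf₁ : ∀ u ∈ Icc 0 U, (1 + u) ^ 2 * |f₁ u| ≤ M) (hf₂ : ∀ u ∈ Icc 0 U, (1 + u) ^ 2 * |f₂ u| ≤ M)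
    (hIΩ : IntervalIntegrable (fun u => Real.exp (γ * u / 4)
      * ((1 - Real.exp (-(γ * u / 4))) / (2 * Real.pi * u)) * (a u ^ 2 + b u ^ 2)) volume 0 U)
    (hIE : IntervalIntegrable (fun u => Real.exp (γ * u / 4) * (a u ^ 2 + b u ^ 2)) volume 0 U)
    (hIf : IntervalIntegrable (fun u => Real.exp (γ * u / 4) * (a u * f₂ u - b u * f₁ u)) volume 0 U)
    (hIg : IntervalIntegrable (fun u => Real.exp (γ * u / 4) * (a u * f₁ u + b u * f₂ u)) volume 0 U)
    (hID₁ : IntervalIntegrable (fun u => Real.exp (γ * u / 4) * (4 * u * (a₁ u ^ 2 + b₁ u ^ 2))) volume 0 U)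
    (hID₂ : IntervalIntegrable (fun u => Real.exp (γ * u / 4) * (m ^ 2 / u * (a u ^ 2 + b u ^ 2))) volume 0 U)
    (hIaφ : IntervalIntegrable (fun u => a u * φa u) volume 0 U)
    (hIbφ : IntervalIntegrable (fun u => b u * φb u) volume 0 U)
    (hIBa₁ : IntervalIntegrable (fun u => 4 * u * φa₁ u ^ 2) volume 0 U)
    (hIBa₂ : IntervalIntegrable (fun u => m ^ 2 / u * φa u ^ 2) volume 0 U)
    (hIBb₁ : IntervalIntegrable (fun u => 4 * u * φb₁ u ^ 2) volume 0 U)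
    (hIBb₂ : IntervalIntegrable (fun u => m ^ 2 / u * φb u ^ 2) volume 0 U)
    (hIua : IntervalIntegrable (fun u => u * a u ^ 2) volume 0 U)
    (hIub : IntervalIntegrable (fun u => u * b u ^ 2) volume 0 U)
    (hIcross : IntervalIntegrable (fun u => b u * φa u - a u * φb u) volume 0 U) :
    ∀ u ∈ Icc 0 u₁, a u ^ 2 + b u ^ 2
      ≤ M ^ 2 * (u₁ * Real.exp (γ * u₁ / 4)) / Rc
          * (4 * (2 * Real.pi * (u₁ + 4 / γ)) * ((γ + 1) * (2 * Real.pi * (u₁ + 4 / γ)) + 4) / ((1 - 16 / (5 * m ^ 2)) * m) ^ 2 + 1 / 2)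
        + 4 * ((γ + 1) * (2 * Real.pi * (u₁ + 4 / γ)) + 4)
          * (Real.exp (γ * u₁ / 4) * (a u₁ * (4 * u₁ * b₁ u₁ + γ * u₁ * b u₁) - b u₁ * (4 * u₁ * a₁ u₁ + γ * u₁ * a u₁)))
          / ((1 - 16 / (5 * m ^ 2)) * m)
        + Real.exp (γ * u₁ / 4) * (a u₁ * (4 * u₁ * a₁ u₁ + γ * u₁ * a u₁) + b u₁ * (4 * u₁ * b₁ u₁ + γ * u₁ * b u₁)
            - γ * u₁ * (a u₁ ^ 2 + b u₁ ^ 2))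
        + γ ^ 2 * Rc / (16 * Real.pi * m) * (1 + 4 * ((γ + 1) * (2 * Real.pi * (u₁ + 4 / γ)) + 4) / ((1 - 16 / (5 * m ^ 2)) * m))
          * ∫ u in u₁..U, u * (a u ^ 2 + b u ^ 2) := by
  have hm0 : 0 < m := by linarith
  have hm0' : m ≠ 0 := hm0.ne'
  have hπ : 0 < Real.pi := Real.pi_pos
  have hRc0 : 0 < Rc := by linarith
  have hU0 : 0 ≤ U := le_trans hu₁.le hu₁U
  have hu₁0 : 0 ≤ u₁ := hu₁.le
  have hM : 0 ≤ M := le_trans (by positivity) (hf₁ 0 (left_mem_Icc.2 hU0))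
  have hsub : Icc 0 u₁ ⊆ Icc 0 U := Icc_subset_Icc le_rfl hu₁U
  -- constants
  set K : ℝ := 2 * Real.pi * (u₁ + 4 / γ) with hKdef
  have hK : 0 < K := by positivity
  set c₁ : ℝ := (1 - 16 / (5 * m ^ 2)) * m with hc₁def
  have hc₁m : m / 5 ≤ c₁ := by
    rw [hc₁def]
    have : 16 / (5 * m ^ 2) ≤ 4 / 5 := by
      rw [div_le_div_iff₀ (by positivity) (by norm_num)]; nlinarith
    nlinarith
  have hc₁ : 0 < c₁ := lt_of_lt_of_le (by positivity) hc₁m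
  -- (Im) and (Re), truncated at `u₁`
  have hIm := core_rotation_coercivity_trunc hγ hm hRc0.le hu₁0 hu₁U ha hb hφa hφb hΦac hΦbc hPac hPbc hφa0 hφb0
    hdera hderb hderφa hderφb hΦa hΦb hPa hPb hφaU hφbU hIΩ hIE hIf hIaφ hIbφ hIBa₁ hIBa₂ hIBb₁ hIBb₂ hIua hIub
  have hID : IntervalIntegrable (fun u => Real.exp (γ * u / 4)
      * (4 * u * (a₁ u ^ 2 + b₁ u ^ 2) + m ^ 2 / u * (a u ^ 2 + b u ^ 2))) volume 0 U := by
    have e : (fun u => Real.exp (γ * u / 4) * (4 * u * (a₁ u ^ 2 + b₁ u ^ 2) + m ^ 2 / u * (a u ^ 2 + b u ^ 2)))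
        = fun u => Real.exp (γ * u / 4) * (4 * u * (a₁ u ^ 2 + b₁ u ^ 2))
          + Real.exp (γ * u / 4) * (m ^ 2 / u * (a u ^ 2 + b u ^ 2)) := by funext u; ring
    rw [e]; exact hID₁.add hID₂
  have hRe := core_dissipation_trunc hγ hm hRc0.le hu₁0 hu₁U ha hb hφa hφb hΦac hΦbc hPac hPbc hφa0 hφb0
    hdera hderb hderφa hderφb hΦa hΦb hPa hPb hφaU hφbU hIΩ hIE hIg hID hIaφ hIbφ hIBa₁ hIBa₂ hIBb₁ hIBb₂ hIua hIub hIcross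
  have hID₁' := intervalIntegrable_mono_left hu₁0 hu₁U hID₁
  have hID₂' := intervalIntegrable_mono_left hu₁0 hu₁U hID₂
  have hDsplit : ∫ u in (0:ℝ)..u₁, Real.exp (γ * u / 4) * (4 * u * (a₁ u ^ 2 + b₁ u ^ 2) + m ^ 2 / u * (a u ^ 2 + b u ^ 2))
      = (∫ u in (0:ℝ)..u₁, Real.exp (γ * u / 4) * (4 * u * (a₁ u ^ 2 + b₁ u ^ 2)))
        + ∫ u in (0:ℝ)..u₁, Real.exp (γ * u / 4) * (m ^ 2 / u * (a u ^ 2 + b u ^ 2)) := by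
    rw [← integral_add hID₁' hID₂']; congr 1; funext u; ring
  rw [hDsplit] at hRe
  -- names (introduced AFTER hIm/hRe so that they are folded there)
  set B₁ : ℝ := Real.exp (γ * u₁ / 4) * (a u₁ * (4 * u₁ * b₁ u₁ + γ * u₁ * b u₁) - b u₁ * (4 * u₁ * a₁ u₁ + γ * u₁ * a u₁)) with hB₁def
  set B₂ : ℝ := Real.exp (γ * u₁ / 4) * (a u₁ * (4 * u₁ * a₁ u₁ + γ * u₁ * a u₁) + b u₁ * (4 * u₁ * b₁ u₁ + γ * u₁ * b u₁)
      - γ * u₁ * (a u₁ ^ 2 + b u₁ ^ 2)) with hB₂def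
  set X : ℝ := ∫ u in u₁..U, u * (a u ^ 2 + b u ^ 2) with hXdef
  set 𝒞 : ℝ := ∫ u in (0:ℝ)..u₁, Real.exp (γ * u / 4)
      * ((1 - Real.exp (-(γ * u / 4))) / (2 * Real.pi * u)) * (a u ^ 2 + b u ^ 2) with h𝒞def
  set IE : ℝ := ∫ u in (0:ℝ)..u₁, Real.exp (γ * u / 4) * (a u ^ 2 + b u ^ 2) with hIEdef
  set I₄ : ℝ := ∫ u in (0:ℝ)..u₁, Real.exp (γ * u / 4) / (1 + u) ^ 4 with hI₄def
  set D : ℝ := ∫ u in (0:ℝ)..u₁, Real.exp (γ * u / 4) * (4 * u * (a₁ u ^ 2 + b₁ u ^ 2)) with hDdef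
  set D₂ : ℝ := ∫ u in (0:ℝ)..u₁, Real.exp (γ * u / 4) * (m ^ 2 / u * (a u ^ 2 + b u ^ 2)) with hD₂def
  have hIΩ' := intervalIntegrable_mono_left hu₁0 hu₁U hIΩ
  have hIE' := intervalIntegrable_mono_left hu₁0 hu₁U hIE
  have hIf' := intervalIntegrable_mono_left hu₁0 hu₁U hIf
  have hIg' := intervalIntegrable_mono_left hu₁0 hu₁U hIg
  have h𝒞0 : 0 ≤ 𝒞 := integral_nonneg hu₁0 (fun u hu => by
    have h1 : 0 ≤ 1 - Real.exp (-(γ * u / 4)) := by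
      have : Real.exp (-(γ * u / 4)) ≤ 1 := Real.exp_le_one_iff.mpr (by nlinarith [hu.1, hγ])
      linarith
    have := hu.1
    positivity)
  have hIE0 : 0 ≤ IE := integral_nonneg hu₁0 (fun u _ => by positivity)
  have hD0 : 0 ≤ D := integral_nonneg hu₁0 (fun u hu => by have := hu.1; positivity)
  have hD₂0 : 0 ≤ D₂ := integral_nonneg hu₁0 (fun u hu => by have := hu.1; positivity)
  have hI₄c : ContinuousOn (fun u : ℝ => Real.exp (γ * u / 4) / (1 + u) ^ 4) (Icc 0 u₁) := by
    apply ContinuousOn.div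
    · exact (Real.continuous_exp.comp (by continuity)).continuousOn
    · exact (continuousOn_const.add continuousOn_id).pow 4
    · intro u hu; have := hu.1; positivity
  have hI₄int : IntervalIntegrable (fun u : ℝ => Real.exp (γ * u / 4) / (1 + u) ^ 4) volume 0 u₁ :=
    hI₄c.intervalIntegrable_of_Icc hu₁0
  have hI₄0 : 0 ≤ I₄ := integral_nonneg hu₁0 (fun u hu => by have := hu.1; positivity)
  have hI₄ : I₄ ≤ u₁ * Real.exp (γ * u₁ / 4) := by
    have h1 : I₄ ≤ ∫ _ in (0:ℝ)..u₁, Real.exp (γ * u₁ / 4) := by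
      apply integral_mono_on hu₁0 hI₄int _root_.intervalIntegrable_const
      intro u hu
      have hE : Real.exp (γ * u / 4) ≤ Real.exp (γ * u₁ / 4) := Real.exp_le_exp.mpr (by nlinarith [hu.2, hγ])
      have h1u : 1 ≤ (1 + u) ^ 4 := one_le_pow₀ (by linarith [hu.1])
      calc Real.exp (γ * u / 4) / (1 + u) ^ 4 ≤ Real.exp (γ * u / 4) / 1 :=
            div_le_div_of_nonneg_left (Real.exp_pos _).le one_pos h1u
        _ ≤ Real.exp (γ * u₁ / 4) := by simpa using hE
    rw [intervalIntegral.integral_const, smul_eq_mul] at h1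
    linarith
  -- (P) `IE ≤ K 𝒞`
  have hP : IE ≤ K * 𝒞 := by
    rw [hIEdef, h𝒞def, ← intervalIntegral.integral_const_mul]
    apply integral_mono_on hu₁0 hIE' (hIΩ'.const_mul _)
    intro u hu
    rcases eq_or_lt_of_le hu.1 with h | h
    · subst h; simp [ha0, hb0]
    · have hs : 0 ≤ a u ^ 2 + b u ^ 2 := by positivity
      have h1 := exp_le_rot_weight hγ h hs
      have h2 : 2 * Real.pi * (u + 4 / γ) ≤ K := by rw [hKdef]; nlinarith [hu.2, hπ]
      have h3 : 0 ≤ Real.exp (γ * u / 4) * ((1 - Real.exp (-(γ * u / 4))) / (2 * Real.pi * u)) * (a u ^ 2 + b u ^ 2) := by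
        have h4 : 0 ≤ 1 - Real.exp (-(γ * u / 4)) := by
          have : Real.exp (-(γ * u / 4)) ≤ 1 := Real.exp_le_one_iff.mpr (by nlinarith [hγ, h])
          linarith
        positivity
      exact h1.trans (mul_le_mul_of_nonneg_right h2 h3)
  -- pointwise AM–GM for the forcing pairings, integrated over `[0, u₁]`
  have hpair : ∀ η : ℝ, 0 < η →
      (∫ u in (0:ℝ)..u₁, Real.exp (γ * u / 4) * (a u * f₂ u - b u * f₁ u)) ≤ η / 2 * IE + M ^ 2 * I₄ / η ∧
      (∫ u in (0:ℝ)..u₁, Real.exp (γ * u / 4) * (a u * f₁ u + b u * f₂ u)) ≤ η / 2 * IE + M ^ 2 * I₄ / η := by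
    intro η hη
    have hrhs : IntervalIntegrable (fun u => η / 2 * (Real.exp (γ * u / 4) * (a u ^ 2 + b u ^ 2))
        + M ^ 2 / η * (Real.exp (γ * u / 4) / (1 + u) ^ 4)) volume 0 u₁ :=
      (hIE'.const_mul _).add (hI₄int.const_mul _)
    have hrhs_val : ∫ u in (0:ℝ)..u₁, (η / 2 * (Real.exp (γ * u / 4) * (a u ^ 2 + b u ^ 2))
        + M ^ 2 / η * (Real.exp (γ * u / 4) / (1 + u) ^ 4)) = η / 2 * IE + M ^ 2 * I₄ / η := by
      rw [integral_add (hIE'.const_mul _) (hI₄int.const_mul _), intervalIntegral.integral_const_mul,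
        intervalIntegral.integral_const_mul, hIEdef, hI₄def]
      ring
    have hpt : ∀ u ∈ Icc 0 u₁,
        Real.exp (γ * u / 4) * (a u * f₂ u - b u * f₁ u)
          ≤ η / 2 * (Real.exp (γ * u / 4) * (a u ^ 2 + b u ^ 2)) + M ^ 2 / η * (Real.exp (γ * u / 4) / (1 + u) ^ 4) ∧
        Real.exp (γ * u / 4) * (a u * f₁ u + b u * f₂ u)
          ≤ η / 2 * (Real.exp (γ * u / 4) * (a u ^ 2 + b u ^ 2)) + M ^ 2 / η * (Real.exp (γ * u / 4) / (1 + u) ^ 4) := by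
      intro u hu
      have hu' : u ∈ Icc 0 U := hsub hu
      have h1u : 0 < (1 + u) ^ 2 := by have := hu.1; positivity
      have hg₁ : |f₁ u| ≤ M / (1 + u) ^ 2 := by rw [le_div_iff₀ h1u]; linarith [hf₁ u hu']
      have hg₂ : |f₂ u| ≤ M / (1 + u) ^ 2 := by rw [le_div_iff₀ h1u]; linarith [hf₂ u hu']
      obtain ⟨hA, hB⟩ := pairing_amgm (a := a u) (b := b u) hη hg₁ hg₂
      have hE0 : 0 ≤ Real.exp (γ * u / 4) := (Real.exp_pos _).le
      have e : Real.exp (γ * u / 4) * (η / 2 * (a u ^ 2 + b u ^ 2) + (M / (1 + u) ^ 2) ^ 2 / η)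
          = η / 2 * (Real.exp (γ * u / 4) * (a u ^ 2 + b u ^ 2)) + M ^ 2 / η * (Real.exp (γ * u / 4) / (1 + u) ^ 4) := by
        field_simp
      constructor
      · have := mul_le_mul_of_nonneg_left hB hE0; linarith
      · have := mul_le_mul_of_nonneg_left hA hE0; linarith
    constructor
    · rw [← hrhs_val]; exact integral_mono_on hu₁0 hIf' hrhs (fun u hu => (hpt u hu).1)
    · rw [← hrhs_val]; exact integral_mono_on hu₁0 hIg' hrhs (fun u hu => (hpt u hu).2)
  -- (Im) algebra with remainder `Z = B₁ + (γ²Rc/16πm) X`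
  have hIm' : c₁ * Rc * 𝒞 + m * ρ * IE
      ≤ (∫ u in (0:ℝ)..u₁, Real.exp (γ * u / 4) * (a u * f₂ u - b u * f₁ u)) + (B₁ + γ ^ 2 * Rc / (16 * Real.pi * m) * X) := by
    have e : (1 - 16 / (5 * m ^ 2)) * (m * Rc) * 𝒞 = c₁ * Rc * 𝒞 := by rw [hc₁def]; ring
    rw [← e]; linarith [hIm]
  have hρK : m * |ρ| * K ≤ c₁ * Rc / 4 := by
    have h1 : |ρ| * K ≤ Rc / 20 := by
      rw [hKdef]
      have : 40 * Real.pi * |ρ| * (u₁ + 4 / γ) = 20 * (|ρ| * (2 * Real.pi * (u₁ + 4 / γ))) := by ring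
      linarith [hρ]
    have h2 : m * |ρ| * K ≤ m * (Rc / 20) := by
      have := mul_le_mul_of_nonneg_left h1 hm0.le; linarith [mul_assoc m (|ρ|) K]
    nlinarith [hc₁m]
  have hη : 0 < c₁ * Rc / K := by positivity
  have hrot := (hpair (c₁ * Rc / K) hη).1
  have h𝒞 : 𝒞 ≤ 4 * K * (M ^ 2 * I₄) / (c₁ ^ 2 * Rc ^ 2) + 4 * (B₁ + γ ^ 2 * Rc / (16 * Real.pi * m) * X) / (c₁ * Rc) :=
    gauss_currency_bound_rem hK hc₁ hRc0 hm0 h𝒞0 hIE0 hP hIm' hrot hρK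
  -- (Re) algebra with remainder `W = B₂ + (γ²Rc/16πm) X`
  have hRe' : D + D₂ ≤ γ * IE + (∫ u in (0:ℝ)..u₁, Real.exp (γ * u / 4) * (a u * f₁ u + b u * f₂ u))
      + 16 / (5 * m) * Rc * 𝒞 + (B₂ + γ ^ 2 * Rc / (16 * Real.pi * m) * X) := by linarith [hRe]
  have hdis := (hpair (2 * Rc) (by positivity)).2
  have hDD := gauss_dissipation_bound_rem hK hc₁ hRc hγ hm h𝒞0 hRe' hP hdis h𝒞
  -- extraction on `(0, u₁]`
  intro u hu
  have hDD' : D + D₂ ≤ M ^ 2 * (u₁ * Real.exp (γ * u₁ / 4)) / Rc * (4 * K * ((γ + 1) * K + 4) / c₁ ^ 2 + 1 / 2)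
      + 4 * ((γ + 1) * K + 4) * (B₁ + γ ^ 2 * Rc / (16 * Real.pi * m) * X) / c₁
      + (B₂ + γ ^ 2 * Rc / (16 * Real.pi * m) * X) := by
    have hA : M ^ 2 * I₄ / Rc ≤ M ^ 2 * (u₁ * Real.exp (γ * u₁ / 4)) / Rc :=
      div_le_div_of_nonneg_right (mul_le_mul_of_nonneg_left hI₄ (by positivity)) hRc0.le
    have hB0 : 0 ≤ 4 * K * ((γ + 1) * K + 4) / c₁ ^ 2 + 1 / 2 := by positivity
    have := mul_le_mul_of_nonneg_right hA hB0
    linarith [hDD]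
  have htarget : D + D₂ ≤ M ^ 2 * (u₁ * Real.exp (γ * u₁ / 4)) / Rc * (4 * K * ((γ + 1) * K + 4) / c₁ ^ 2 + 1 / 2)
      + 4 * ((γ + 1) * K + 4) * B₁ / c₁ + B₂
      + γ ^ 2 * Rc / (16 * Real.pi * m) * (1 + 4 * ((γ + 1) * K + 4) / c₁) * X := by
    have e : 4 * ((γ + 1) * K + 4) * (B₁ + γ ^ 2 * Rc / (16 * Real.pi * m) * X) / c₁
        + (B₂ + γ ^ 2 * Rc / (16 * Real.pi * m) * X)
        = 4 * ((γ + 1) * K + 4) * B₁ / c₁ + B₂ + γ ^ 2 * Rc / (16 * Real.pi * m) * (1 + 4 * ((γ + 1) * K + 4) / c₁) * X := by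
      field_simp
      ring
    linarith [hDD', e]
  rcases eq_or_lt_of_le hu.1 with h | hu0
  · subst h
    rw [ha0, hb0]
    have : (0:ℝ) ^ 2 + 0 ^ 2 = 0 := by norm_num
    rw [this]
    have hs0 : 0 ≤ D + D₂ := by linarith
    simpa [hKdef, hc₁def, hB₁def, hB₂def, hXdef] using hs0.trans htarget
  · have hX := core_extraction_le hγ hm0' hu₁ (ha.mono hsub) (hb.mono hsub)
      (ha₁.mono (fun v hv => ⟨hv.1, le_trans hv.2 hu₁U⟩)) (hb₁.mono (fun v hv => ⟨hv.1, le_trans hv.2 hu₁U⟩))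
      (fun v hv => hdera v ⟨hv.1, lt_of_lt_of_le hv.2 hu₁U⟩) (fun v hv => hderb v ⟨hv.1, lt_of_lt_of_le hv.2 hu₁U⟩)
      hID₁' hID₂' u ⟨hu0, hu.2⟩
    have h3m : 3 / m ^ 2 ≤ 1 := by rw [div_le_iff₀ (by positivity)]; nlinarith
    have h1 : 3 / m ^ 2 * D₂ ≤ D₂ := by have := mul_le_mul_of_nonneg_right h3m hD₂0; linarith
    have h2 : 1 / 4 * D ≤ D := by linarith
    have : a u ^ 2 + b u ^ 2 ≤ D + D₂ := by
      have hX' : a u ^ 2 + b u ^ 2 ≤ 3 / m ^ 2 * D₂ + 1 / 4 * D := by simpa [hDdef, hD₂def] using hX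
      linarith
    simpa [hKdef, hc₁def, hB₁def, hB₂def, hXdef] using this.trans htarget

end Summit.NavierStokesRegularity.NavierStokesRegularity.Theorems.DefectColumnGate

end
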